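import Mathlib
import HarnessLib

/-!
# Sauvalle's unimodular-root theorem for the local zeta of a `p`-adic second degree character

Topic `NumberTheory/LFunctions`; **proof file** (one definition with body + theorems; no named facts).

B. Sauvalle (*Acta Arith.* 177 (2017), §3.8.1, Theorem 1) shows that for a non-degenerate second
degree character `f(x) = ψ(½ax² + bx)` on a `𝔭`-adic field (`q = N𝔭`, `γ_f` the Weil index,
`|γ_f| = 1`), all zeros of the local zeta function `ζ_f(s)` lie on `Re s = ½`.  With `X = q^{s-½}`
the zero equation is the self-inversive polynomial equation (unramified case, conductor-type
exponent `k ≥ 1`)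

  `P(X) = γ X^{2k} - γ q^{-1/2} X^{2k-1} - q^{-1/2} X + 1 = 0`,

and the printed proof is elementary: for `X = e^{iφ}`, `γ^{-1/2} e^{-ikφ} P(e^{iφ})` is twice the real
part of `√γ e^{ikφ}(1 - q^{-1/2} e^{-iφ})`, which changes sign `2k` times as `φ` runs over a period
because `q^{-1/2} < 1`; hence `P` has `2k` distinct zeros on the unit circle, i.e. all of them.

We formalise exactly this argument, for the polynomial with a real parameter `t` in place of
`q^{-1/2}`; the theorem holds for every `|t| < 1` and every `γ` on the unit circle:

* `Sauvalle2017.poly γ t k = C γ X^{2k} - C (γ t) X^{2k-1} - C t X + 1`;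
* `Sauvalle2017.norm_eq_one_of_isRoot` — every root is unimodular;
* `Sauvalle2017.card_roots`, `Sauvalle2017.nodup_roots` — there are exactly `2k` roots and they
  are simple;
* `Sauvalle2017.norm_eq_one_of_isRoot_sqrt` — the printed normalisation `t = q^{-1/2}`, `q > 1`.

(For `t ≥ 2`, e.g. the census's planted negative twin, the conclusion fails: `P(0) = 1 > 0 > P(1)`
puts a real root in `(0,1)`; not formalised here.)

## References

* [Sauvalle2017] B. Sauvalle, *On weak Mellin transforms, second degree characters and the Riemann
  hypothesis*, Acta Arith. 177 (2017) 219–275 = arXiv:1502.02633, §3.8.1 Theorem 1 and its proof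
  (arXiv pp. 14–15, read at page).

## Mathlib / tree search

No prior formalisation (`lean search "Sauvalle|self-inversive|unimodular root"`: none, 2026-08-20).
Used: `intermediate_value_Ioo`, `intermediate_value_Ioo'`, `Complex.exp_eq_exp_iff_exists_int`,
`Complex.two_cos`, `Complex.norm_mul_exp_arg_mul_I`, `Polynomial.card_roots'`,
`Multiset.toFinset_card_eq_card_iff_nodup`, `Finset.eq_of_subset_of_card_le`.
-/

open Polynomial Finset

namespace Literature.NumberTheory.LFunctions

namespace Sauvalle2017

/-- Sauvalle's polynomial `P_{γ,t,k}(X) = γ X^{2k} - γ t X^{2k-1} - t X + 1` (in the paper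
`t = q^{-1/2}`, `γ = γ_f` the Weil index, `X = q^{s-1/2}`). [cite: Sauvalle2017, §3.8.1 Theorem 1 (proof)] -/
noncomputable def poly (γ : ℂ) (t : ℝ) (k : ℕ) : ℂ[X] :=
  C γ * X ^ (2 * k) - C (γ * t) * X ^ (2 * k - 1) - C (t : ℂ) * X + 1

/-- `P(0) = 1`, so `P ≠ 0` (`k ≥ 1`). [cite: Sauvalle2017, §3.8.1 Theorem 1 (proof)] -/
theorem poly_ne_zero (γ : ℂ) (t : ℝ) {k : ℕ} (hk : 0 < k) : poly γ t k ≠ 0 := by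
  intro h
  have h0 := congrArg (fun p : ℂ[X] => p.eval 0) h
  simp only [poly, eval_add, eval_sub, eval_mul, eval_C, eval_pow, eval_X, eval_one, eval_zero,
    zero_pow (by omega : 2 * k ≠ 0), zero_pow (by omega : 2 * k - 1 ≠ 0), mul_zero, sub_zero,
    zero_add] at h0
  exact one_ne_zero h0

/-- `deg P ≤ 2k`. [cite: Sauvalle2017, §3.8.1 Theorem 1 (proof: "cannot be greater than 2k")] -/
theorem natDegree_poly_le (γ : ℂ) (t : ℝ) {k : ℕ} (hk : 0 < k) :
    (poly γ t k).natDegree ≤ 2 * k := by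
  unfold poly
  refine (natDegree_add_le _ _).trans (max_le ?_ (by simp))
  refine (natDegree_sub_le _ _).trans (max_le ?_ ?_)
  · refine (natDegree_sub_le _ _).trans (max_le ?_ ?_)
    · exact natDegree_C_mul_X_pow_le _ _
    · exact (natDegree_C_mul_X_pow_le _ _).trans (by omega)
  · exact (natDegree_C_mul_le _ _).trans (natDegree_X_le.trans (by omega))

/-- The master statement: for `‖γ‖ = 1`, `|t| < 1`, `k ≥ 1`, the roots of `P_{γ,t,k}` form a set of
`2k` unimodular numbers and `P` has exactly `2k` roots counted with multiplicity (so all simple).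
[cite: Sauvalle2017, §3.8.1 Theorem 1] -/
theorem roots_spec {γ : ℂ} (hγ : ‖γ‖ = 1) {t : ℝ} (ht : |t| < 1) {k : ℕ} (hk : 0 < k) :
    ∃ S : Finset ℂ, S.card = 2 * k ∧ (∀ z ∈ S, ‖z‖ = 1) ∧ (poly γ t k).roots.toFinset = S ∧
      Multiset.card (poly γ t k).roots = 2 * k := by
  obtain ⟨m, rfl⟩ : ∃ m, k = m + 1 := ⟨k - 1, by omega⟩
  -- a square root `c = e^{iθ}` of `γ`
  set θ : ℝ := Complex.arg γ / 2 with hθ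
  set c : ℂ := Complex.exp (θ * Complex.I) with hc
  have hc2 : c ^ 2 = γ := by
    have h1 : c ^ 2 = Complex.exp (Complex.arg γ * Complex.I) := by
      rw [hc, sq, ← Complex.exp_add]
      congr 1
      rw [hθ]
      push_cast
      ring
    rw [h1]
    have h2 := Complex.norm_mul_exp_arg_mul_I γ
    rw [hγ] at h2
    simpa using h2
  have hcn : ‖c‖ = 1 := by rw [hc]; exact Complex.norm_exp_ofReal_mul_I θ
  have hc0 : c ≠ 0 := fun h => by simp [h] at hcn
  -- the real function `F(φ) = 2 cos(θ + (m+1)φ) - t · 2 cos(θ + mφ)`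
  set F : ℝ → ℝ := fun φ => 2 * Real.cos (θ + (m + 1) * φ) - t * (2 * Real.cos (θ + m * φ))
    with hF
  have hF_cont : Continuous F := by
    rw [hF]
    fun_prop
  -- `2 cos a = e^{ia} + e^{-ia}` as complex numbers
  have hcos : ∀ a : ℝ, ((2 * Real.cos a : ℝ) : ℂ) =
      Complex.exp (a * Complex.I) + Complex.exp (-(a * Complex.I)) := by
    intro a
    rw [show ((2 * Real.cos a : ℝ) : ℂ) = 2 * Complex.cos a by push_cast; ring, Complex.two_cos,
      neg_mul]
  -- key identity: `P(e^{iφ}) = c e^{i(m+1)φ} F(φ)`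
  have hkey : ∀ φ : ℝ, (poly γ t (m + 1)).eval (Complex.exp (φ * Complex.I)) =
      c * Complex.exp (φ * Complex.I) ^ (m + 1) * (F φ : ℂ) := by
    intro φ
    set E : ℂ := Complex.exp (φ * Complex.I) with hE
    have hE0 : E ≠ 0 := Complex.exp_ne_zero _
    have hA : Complex.exp (((θ + (m + 1) * φ : ℝ) : ℂ) * Complex.I) = c * E ^ (m + 1) := by
      rw [hc, hE, ← Complex.exp_nat_mul, ← Complex.exp_add]
      congr 1
      push_cast
      ring
    have hA' : Complex.exp (-((((θ + (m + 1) * φ : ℝ) : ℂ)) * Complex.I)) =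
        (c * E ^ (m + 1))⁻¹ := by
      rw [Complex.exp_neg, hA]
    have hB : Complex.exp (((θ + m * φ : ℝ) : ℂ) * Complex.I) = c * E ^ m := by
      rw [hc, hE, ← Complex.exp_nat_mul, ← Complex.exp_add]
      congr 1
      push_cast
      ring
    have hB' : Complex.exp (-((((θ + m * φ : ℝ) : ℂ)) * Complex.I)) = (c * E ^ m)⁻¹ := by
      rw [Complex.exp_neg, hB]
    have hFc : (F φ : ℂ) = (c * E ^ (m + 1) + (c * E ^ (m + 1))⁻¹) -
        t * (c * E ^ m + (c * E ^ m)⁻¹) := by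
      rw [hF]
      simp only
      rw [Complex.ofReal_sub, Complex.ofReal_mul t, hcos, hcos, hA, hA', hB, hB']
    rw [hFc]
    simp only [poly, eval_add, eval_sub, eval_mul, eval_C, eval_pow, eval_X, eval_one]
    rw [show 2 * (m + 1) - 1 = 2 * m + 1 by omega, show 2 * (m + 1) = 2 * m + 2 by omega, ← hc2]
    field_simp
    ring
  -- the sample points `φ_j = (jπ - θ)/(m+1)`, `j = 0, …, 2m+2`
  set φs : ℕ → ℝ := fun j => ((j : ℝ) * Real.pi - θ) / (m + 1) with hφs
  have hm1 : (0 : ℝ) < m + 1 := by positivity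
  have hφ_mono : ∀ j : ℕ, φs j < φs (j + 1) := by
    intro j
    rw [hφs]
    simp only
    rw [div_lt_div_iff_of_pos_right hm1]
    push_cast
    nlinarith [Real.pi_pos]
  have hφ_mono' : StrictMono φs := strictMono_nat_of_lt_succ hφ_mono
  have hφ_span : φs (2 * m + 2) - φs 0 = 2 * Real.pi := by
    rw [hφs]
    simp only
    field_simp
    push_cast
    ring
  -- the value of `F` at `φ_j`: `2 (-1)^j (1 - t cos φ_j)`
  have hFval : ∀ j : ℕ, F (φs j) = 2 * (-1) ^ j * (1 - t * Real.cos (φs j)) := by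
    intro j
    have h1 : θ + (m + 1) * φs j = j * Real.pi := by
      rw [hφs]
      simp only
      field_simp
      ring
    have h2 : θ + m * φs j = j * Real.pi - φs j := by
      have : (m : ℝ) * φs j = (m + 1) * φs j - φs j := by ring
      rw [this, ← h1]
      ring
    rw [hF]
    simp only
    rw [h1, h2, Real.cos_nat_mul_pi, Real.cos_sub, Real.cos_nat_mul_pi, Real.sin_nat_mul_pi]
    ring
  have hpos : ∀ j : ℕ, 0 < 1 - t * Real.cos (φs j) := by
    intro j
    have h1 : |t * Real.cos (φs j)| < 1 := by
      rw [abs_mul]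
      calc |t| * |Real.cos (φs j)| ≤ |t| * 1 :=
            mul_le_mul_of_nonneg_left (Real.abs_cos_le_one _) (abs_nonneg t)
        _ < 1 := by rw [mul_one]; exact ht
    have h2 := (abs_lt.1 h1).2
    linarith
  -- a zero of `F` strictly between consecutive sample points
  have hzero : ∀ j : ℕ, ∃ ψ : ℝ, φs j < ψ ∧ ψ < φs (j + 1) ∧ F ψ = 0 := by
    intro j
    have hcont : ContinuousOn F (Set.Icc (φs j) (φs (j + 1))) := hF_cont.continuousOn
    rcases neg_one_pow_eq_or ℝ j with h | h
    · -- F(φ_j) > 0 > F(φ_{j+1})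
      have ha : 0 < F (φs j) := by rw [hFval, h]; nlinarith [hpos j]
      have hb : F (φs (j + 1)) < 0 := by
        rw [hFval, pow_succ, h]; nlinarith [hpos (j + 1)]
      obtain ⟨ψ, hψ, hψ0⟩ := intermediate_value_Ioo' (hφ_mono j).le hcont ⟨hb, ha⟩
      exact ⟨ψ, hψ.1, hψ.2, hψ0⟩
    · have ha : F (φs j) < 0 := by rw [hFval, h]; nlinarith [hpos j]
      have hb : 0 < F (φs (j + 1)) := by
        rw [hFval, pow_succ, h]; nlinarith [hpos (j + 1)]
      obtain ⟨ψ, hψ, hψ0⟩ := intermediate_value_Ioo (hφ_mono j).le hcont ⟨ha, hb⟩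
      exact ⟨ψ, hψ.1, hψ.2, hψ0⟩
  choose ψ hψ using hzero
  -- the 2m+2 roots `z_j = e^{iψ_j}`, `j < 2m+2`
  set z : Fin (2 * m + 2) → ℂ := fun j => Complex.exp (ψ j * Complex.I) with hz
  have hz_root : ∀ j, (poly γ t (m + 1)).IsRoot (z j) := by
    intro j
    rw [IsRoot, hz]
    simp only
    rw [hkey, (hψ j).2.2]
    simp
  have hz_norm : ∀ j, ‖z j‖ = 1 := fun j => Complex.norm_exp_ofReal_mul_I _
  have hψ_mono : StrictMono (fun j : Fin (2 * m + 2) => ψ j) := by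
    intro i j hij
    have hij' : (i : ℕ) + 1 ≤ (j : ℕ) := hij
    calc ψ i < φs (i + 1) := (hψ i).2.1
      _ ≤ φs j := hφ_mono'.monotone hij'
      _ < ψ j := (hψ j).1
  have hψ_range : ∀ j : Fin (2 * m + 2), φs 0 < ψ j ∧ ψ j < φs (2 * m + 2) := by
    intro j
    refine ⟨(hφ_mono'.monotone (Nat.zero_le _)).trans_lt (hψ j).1, (hψ j).2.1.trans_le ?_⟩
    exact hφ_mono'.monotone (by omega)
  have hz_inj : Function.Injective z := by
    intro i j hij
    by_contra hne
    rw [hz] at hij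
    simp only at hij
    obtain ⟨n, hn⟩ := Complex.exp_eq_exp_iff_exists_int.1 hij
    have hreal : ψ i = ψ j + n * (2 * Real.pi) := by
      have := congrArg Complex.im hn
      simpa using this
    have hlt : |ψ i - ψ j| < 2 * Real.pi := by
      have h1 := hψ_range i
      have h2 := hψ_range j
      rw [abs_lt]
      constructor <;> linarith [hφ_span]
    have hn0 : n = 0 := by
      have h2pi : (0 : ℝ) < 2 * Real.pi := by positivity
      have h3 : |(n : ℝ) * (2 * Real.pi)| < 2 * Real.pi := by
        have : ψ i - ψ j = n * (2 * Real.pi) := by linarith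
        rw [← this]
        exact hlt
      rw [abs_mul, abs_of_pos h2pi, mul_lt_iff_lt_one_left h2pi] at h3
      have h4 : |n| < 1 := by exact_mod_cast h3
      exact Int.abs_lt_one_iff.1 h4
    rw [hn0] at hreal
    simp only [Int.cast_zero, zero_mul, add_zero] at hreal
    exact hne (Fin.ext_iff.2 (by
      by_contra hne'
      rcases lt_or_gt_of_ne hne' with h | h
      · exact absurd hreal (ne_of_lt (hψ_mono (Fin.lt_def.2 h)))
      · exact absurd hreal (ne_of_gt (hψ_mono (Fin.lt_def.2 h)))))
  -- counting
  set S : Finset ℂ := Finset.univ.image z with hS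
  have hS_card : S.card = 2 * (m + 1) := by
    rw [hS, Finset.card_image_of_injective _ hz_inj, Finset.card_univ, Fintype.card_fin]
    ring
  have hP0 : poly γ t (m + 1) ≠ 0 := poly_ne_zero γ t (Nat.succ_pos m)
  have hS_sub : S ⊆ (poly γ t (m + 1)).roots.toFinset := by
    intro w hw
    rw [hS, Finset.mem_image] at hw
    obtain ⟨j, _, rfl⟩ := hw
    rw [Multiset.mem_toFinset, Polynomial.mem_roots hP0]
    exact hz_root j
  have hcard_le : Multiset.card (poly γ t (m + 1)).roots ≤ 2 * (m + 1) :=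
    (Polynomial.card_roots' _).trans (natDegree_poly_le γ t (Nat.succ_pos m))
  have h1 : (poly γ t (m + 1)).roots.toFinset.card ≤ S.card :=
    (Multiset.toFinset_card_le _).trans (hcard_le.trans hS_card.ge)
  have hSeq : S = (poly γ t (m + 1)).roots.toFinset := Finset.eq_of_subset_of_card_le hS_sub h1
  refine ⟨S, hS_card, ?_, hSeq.symm, ?_⟩
  · intro w hw
    rw [hS, Finset.mem_image] at hw
    obtain ⟨j, _, rfl⟩ := hw
    exact hz_norm j
  · refine le_antisymm hcard_le ?_
    rw [← hS_card, hSeq]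
    exact Multiset.toFinset_card_le _

/-- **Sauvalle 2017, Theorem 1 (the polynomial statement).** For `‖γ‖ = 1`, `|t| < 1` and `k ≥ 1`,
every root of `γ X^{2k} - γ t X^{2k-1} - t X + 1` lies on the unit circle.
[cite: Sauvalle2017, §3.8.1 Theorem 1] -/
theorem norm_eq_one_of_isRoot {γ : ℂ} (hγ : ‖γ‖ = 1) {t : ℝ} (ht : |t| < 1) {k : ℕ} (hk : 0 < k)
    {z : ℂ} (hz : (poly γ t k).IsRoot z) : ‖z‖ = 1 := by
  obtain ⟨S, -, hS1, hS2, -⟩ := roots_spec hγ ht hk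
  apply hS1
  rw [← hS2, Multiset.mem_toFinset, Polynomial.mem_roots (poly_ne_zero γ t hk)]
  exact hz

/-- `P_{γ,t,k}` has exactly `2k` roots counted with multiplicity (`‖γ‖ = 1`, `|t| < 1`, `k ≥ 1`).
[cite: Sauvalle2017, §3.8.1 Theorem 1 (proof: "exactly 2k solutions on the unit circle")] -/
theorem card_roots {γ : ℂ} (hγ : ‖γ‖ = 1) {t : ℝ} (ht : |t| < 1) {k : ℕ} (hk : 0 < k) :
    Multiset.card (poly γ t k).roots = 2 * k := by
  obtain ⟨S, -, -, -, h⟩ := roots_spec hγ ht hk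
  exact h

/-- All roots of `P_{γ,t,k}` are simple (`‖γ‖ = 1`, `|t| < 1`, `k ≥ 1`): the `2k` zeros on the
circle are distinct. [cite: Sauvalle2017, §3.8.1 Theorem 1 (proof: "2k distinct zeroes")] -/
theorem nodup_roots {γ : ℂ} (hγ : ‖γ‖ = 1) {t : ℝ} (ht : |t| < 1) {k : ℕ} (hk : 0 < k) :
    (poly γ t k).roots.Nodup := by
  obtain ⟨S, hS0, -, hS2, hS3⟩ := roots_spec hγ ht hk
  rw [← Multiset.toFinset_card_eq_card_iff_nodup, hS2, hS0, hS3]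

/-- The printed normalisation: `q > 1`, `t = q^{-1/2}`: every root of
`γ X^{2k} - γ q^{-1/2} X^{2k-1} - q^{-1/2} X + 1` is unimodular (`X = q^{s-1/2}` ⇒ `Re s = 1/2`).
[cite: Sauvalle2017, §3.8.1 Theorem 1] -/
theorem norm_eq_one_of_isRoot_sqrt {γ : ℂ} (hγ : ‖γ‖ = 1) {q : ℝ} (hq : 1 < q) {k : ℕ}
    (hk : 0 < k) {z : ℂ} (hz : (poly γ (Real.sqrt q)⁻¹ k).IsRoot z) : ‖z‖ = 1 := by
  refine norm_eq_one_of_isRoot hγ ?_ hk hz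
  have h1 : 1 < Real.sqrt q := by
    rw [show (1 : ℝ) = Real.sqrt 1 by simp]
    exact Real.sqrt_lt_sqrt zero_le_one hq
  rw [abs_of_pos (inv_pos.2 (zero_lt_one.trans h1))]
  exact inv_lt_one_of_one_lt₀ h1

end Sauvalle2017

end Literature.NumberTheory.LFunctions
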